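import Summits.RiemannHypothesis.RiemannHypothesis.Theorems.Splittings.LinearRayDipCertificateCore
import Summits.RiemannHypothesis.RiemannHypothesis.Theorems.Splittings.LinearRayTwoPoint
import HarnessLib

/-!
# The quadrature-free DIP CERTIFICATE against the linear-factor ray (route DBN, `LinearRayDipCertificate`)

Cell rh-split (D-0116 arm), ENGINE 5 (rh-splitx-eng-5 g4); route item `stmt-RiemannHypothesis-21602`
(`LinearRayDipCertificate`, LINE «QUADRATURE-FREE DIP SCHEDULE» of planner rh-idea-2), signature VERBATIM.  At a dip
(`σ = 1`: `H_0(x) > 0 > H_0(x′) ≥ −d`, `H_0″(x′) ≥ F₂`) or bump (`σ = −1`) of `H_0 = deBruijnH 0` on `[0, ∞)`, six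
numbers `d, F₁, F₂, M₃, P, B` and ONE margin inequality refute `HasOnlyRealZeros (linearFactorH a)` for EVERY
`a ∈ [a₁, a₂]` (`linearRayDipCertificate`) — no quadrature of the forward average, no `a`-cells.  Proof: the core
file's lower bound (three integrations by parts + sharp cubic Taylor) for `g = σ·Re H_0^{(0)}` (derivative data
`σ·Re H_0^{(k)}` from `XiMoments` via `LinearRayFiniteReach`); every error term is monotone in `a` on `[a₁, a₂]`
(`margin_at`: `a ↦ a²e^{−aℓ}` is decreasing for `aℓ ≥ 2`), so the margin makes `σ·Q_a > 0` on `[x, x′]`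
(`dip_fwdAvg_pos`) and the tree's two-point certificate `LinearRayTwoPoint.not_linearRay_of_signChange(′)` concludes.
With barrier B20 (`LinearRayFiniteReach`) this is the exact finite reach `a₂·gap < 2` of a pair; RH-free, std axioms.
HONEST LABEL: negative-side bookkeeping on the RH-STRENGTHENING linear-factor ray
(`riemannHypothesis_of_exists_linearRay`); not a splitting; nothing here bears on the truth of RH.
-/

set_option linter.dupNamespace false

noncomputable section

namespace Summit.RiemannHypothesis.RiemannHypothesis.Theorems.Splittings.LinearRayDipCertificate

open Set MeasureTheory Filter Topology intervalIntegral
open Literature.NumberTheory.LFunctions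
open Literature.Barriers.RiemannHypothesis (linearFactorH)
open Summit.RiemannHypothesis.RiemannHypothesis.Theorems.Splittings.LinearRayFiniteReach
open Summit.RiemannHypothesis.RiemannHypothesis.Theorems.Splittings.LinearRayTwoPoint

/-! ## The margin is monotone in `a`; positivity of the forward average -/

/-- **Monotonicity of the margin in `a`.** On `[a₁, a₂]` with `a₁ℓ ≥ 2` every error term of the dip
certificate is bounded by its value at `a₂` (polynomial terms) or at `a₁` (`2/a` and `a²e^{−aℓ}`, the latter
decreasing for `aℓ ≥ 2`), so the margin at `(a₁, a₂)` implies the margin at `a`. [folklore] -/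
theorem margin_at {a₁ a₂ a ℓ d F₁ F₂ M₃ W P B : ℝ} (ha₁ : 0 < a₁) (haℓ : 2 ≤ a₁ * ℓ) (ha : a ∈ Icc a₁ a₂)
    (hdnn : 0 ≤ d) (hF1nn : 0 ≤ F₁) (hM3nn : 0 ≤ M₃) (hW0 : 0 ≤ W) (hPB : 0 ≤ P + B)
    (hmargin : 2 * a₂ ^ 2 * d + 2 * F₁ * (a₂ + a₂ ^ 2 * W) +
      M₃ * (a₂ ^ 2 * W ^ 3 / 3 + a₂ * W ^ 2 + 2 * W + 2 / a₁) +
      2 * a₁ ^ 2 * Real.exp (-(a₁ * ℓ)) * (P + B) < F₂) :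
    2 * a ^ 2 * d + 2 * F₁ * (a + a ^ 2 * W) + M₃ * (a ^ 2 * W ^ 3 / 3 + a * W ^ 2 + 2 * W + 2 / a) +
      2 * a ^ 2 * Real.exp (-(a * ℓ)) * (P + B) < F₂ := by
  have ha0 : 0 < a := lt_of_lt_of_le ha₁ ha.1
  have hpow2 : a ^ 2 ≤ a₂ ^ 2 := pow_le_pow_left₀ ha0.le ha.2 2
  have hterm1 : 2 * a ^ 2 * d ≤ 2 * a₂ ^ 2 * d :=
    mul_le_mul_of_nonneg_right (mul_le_mul_of_nonneg_left hpow2 (by norm_num)) hdnn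
  have hterm2 : 2 * F₁ * (a + a ^ 2 * W) ≤ 2 * F₁ * (a₂ + a₂ ^ 2 * W) :=
    mul_le_mul_of_nonneg_left (add_le_add ha.2 (mul_le_mul_of_nonneg_right hpow2 hW0)) (by positivity)
  have hterm3 : M₃ * (a ^ 2 * W ^ 3 / 3 + a * W ^ 2 + 2 * W + 2 / a) ≤
      M₃ * (a₂ ^ 2 * W ^ 3 / 3 + a₂ * W ^ 2 + 2 * W + 2 / a₁) := by
    refine mul_le_mul_of_nonneg_left ?_ hM3nn
    have h2 : 2 / a ≤ 2 / a₁ := div_le_div_of_nonneg_left (by norm_num) ha₁ ha.1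
    have hW3 : 0 ≤ W ^ 3 := by positivity
    have hW2 : 0 ≤ W ^ 2 := by positivity
    have e1 : a ^ 2 * W ^ 3 / 3 ≤ a₂ ^ 2 * W ^ 3 / 3 :=
      div_le_div_of_nonneg_right (mul_le_mul_of_nonneg_right hpow2 hW3) (by norm_num)
    have e2 : a * W ^ 2 ≤ a₂ * W ^ 2 := mul_le_mul_of_nonneg_right ha.2 hW2
    linarith
  -- a²e^{−aℓ} ≤ a₁²e^{−a₁ℓ}
  have hkey : a ^ 2 * Real.exp (-(a * ℓ)) ≤ a₁ ^ 2 * Real.exp (-(a₁ * ℓ)) := by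
    have hlog : Real.log a - Real.log a₁ ≤ (a - a₁) / a₁ := by
      have h := Real.log_le_sub_one_of_pos (show 0 < a / a₁ by positivity)
      rw [Real.log_div ha0.ne' ha₁.ne'] at h
      have e : a / a₁ - 1 = (a - a₁) / a₁ := by field_simp
      linarith [e.le, e.ge]
    have h2 : 2 * ((a - a₁) / a₁) ≤ (a - a₁) * ℓ := by
      rw [show 2 * ((a - a₁) / a₁) = (a - a₁) * (2 / a₁) by ring]
      exact mul_le_mul_of_nonneg_left (by rw [div_le_iff₀ ha₁]; linarith) (by linarith [ha.1])
    have h3 : Real.log (a ^ 2 * Real.exp (-(a * ℓ))) ≤ Real.log (a₁ ^ 2 * Real.exp (-(a₁ * ℓ))) := by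
      rw [Real.log_mul (by positivity) (Real.exp_pos _).ne', Real.log_mul (by positivity) (Real.exp_pos _).ne',
        Real.log_exp, Real.log_exp, Real.log_pow, Real.log_pow]
      push_cast
      linarith
    exact (Real.log_le_log_iff (by positivity) (by positivity)).1 h3
  have hterm4 : 2 * a ^ 2 * Real.exp (-(a * ℓ)) * (P + B) ≤ 2 * a₁ ^ 2 * Real.exp (-(a₁ * ℓ)) * (P + B) := by
    have := mul_le_mul_of_nonneg_right hkey hPB
    linarith
  linarith

/-- **Positivity of the forward average on `[x, x′]` from the six numbers and the margin** (abstract `C³`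
function; the analytic core of the dip certificate). [folklore] -/
theorem dip_fwdAvg_pos {g g₁ g₂ g₃ : ℝ → ℝ} (hd0 : ∀ x, HasDerivAt g (g₁ x) x) (hd1 : ∀ x, HasDerivAt g₁ (g₂ x) x)
    (hd2 : ∀ x, HasDerivAt g₂ (g₃ x) x) (hc3 : Continuous g₃) {M₀ : ℝ} (hM₀ : ∀ x, |g x| ≤ M₀)
    {x x' ℓ a₁ a₂ d F₁ F₂ M₃ P B : ℝ} (hxx' : x < x') (hℓ : 0 < ℓ) (ha₁ : 0 < a₁) (haℓ : 2 ≤ a₁ * ℓ)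
    (hB0 : 0 ≤ B) (hd : -d ≤ g x') (hneg : g x' < 0) (hF1 : |g₁ x'| ≤ F₁) (hF2 : F₂ ≤ g₂ x')
    (hM3 : ∀ t ∈ Icc x (x' + ℓ), |g₃ t| ≤ M₃)
    (hP : ∀ t ∈ Icc (x + ℓ) (x' + ℓ), |g t| + |g₁ t| / a₁ + |g₂ t| / a₁ ^ 2 ≤ P)
    (hB : ∀ t : ℝ, x + ℓ ≤ t → -B ≤ g t)
    (hmargin : 2 * a₂ ^ 2 * d + 2 * F₁ * (a₂ + a₂ ^ 2 * (x' - x)) +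
      M₃ * (a₂ ^ 2 * (x' - x) ^ 3 / 3 + a₂ * (x' - x) ^ 2 + 2 * (x' - x) + 2 / a₁) +
      2 * a₁ ^ 2 * Real.exp (-(a₁ * ℓ)) * (P + B) < F₂)
    {a : ℝ} (ha : a ∈ Icc a₁ a₂) {s : ℝ} (hs : s ∈ Icc x x') :
    0 < ∫ t in Ioi (0:ℝ), g (s + t) * Real.exp (-(a * t)) := by
  have ha0 : 0 < a := lt_of_lt_of_le ha₁ ha.1
  have ha2 : 0 < a ^ 2 := by positivity
  set W := x' - x with hW
  have hwW : x' - s ≤ W := by rw [hW]; linarith [hs.1]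
  have hw0 : 0 ≤ x' - s := by linarith [hs.2]
  have hW0 : 0 ≤ W := hw0.trans hwW
  -- nonnegativity of the data
  have hM3nn : 0 ≤ M₃ := (abs_nonneg _).trans (hM3 x' ⟨hxx'.le, by linarith⟩)
  have hF1nn : 0 ≤ F₁ := (abs_nonneg _).trans hF1
  have hdnn : 0 ≤ d := by linarith
  have hPnn : 0 ≤ P := by
    have := hP (x + ℓ) ⟨le_rfl, by linarith⟩
    have h1 : 0 ≤ |g₁ (x + ℓ)| / a₁ := by positivity
    have h2 : 0 ≤ |g₂ (x + ℓ)| / a₁ ^ 2 := by positivity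
    linarith [abs_nonneg (g (x + ℓ))]
  have hPB : 0 ≤ P + B := by linarith
  have hm := margin_at ha₁ haℓ ha hdnn hF1nn hM3nn hW0 hPB hmargin
  have hF20 : 0 ≤ F₂ := by
    have h0 : 0 ≤ 2 * a ^ 2 * d := by positivity
    have h1 : 0 ≤ 2 * F₁ * (a + a ^ 2 * W) := by positivity
    have h2 : 0 ≤ M₃ * (a ^ 2 * W ^ 3 / 3 + a * W ^ 2 + 2 * W + 2 / a) := by positivity
    have h3 : 0 ≤ 2 * a ^ 2 * Real.exp (-(a * ℓ)) * (P + B) := by positivity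
    linarith
  -- (1) the analytic lower bound at s
  have hM3s : ∀ t ∈ Icc s (x' + ℓ), |g₃ t| ≤ M₃ := fun t ht => hM3 t ⟨hs.1.trans ht.1, ht.2⟩
  have hPs : |g (s + ℓ)| + |g₁ (s + ℓ)| / a + |g₂ (s + ℓ)| / a ^ 2 ≤ P := by
    have h := hP (s + ℓ) ⟨by linarith [hs.1], by linarith [hs.2]⟩
    have h1 : |g₁ (s + ℓ)| / a ≤ |g₁ (s + ℓ)| / a₁ := div_le_div_of_nonneg_left (abs_nonneg _) ha₁ ha.1
    have h2 : |g₂ (s + ℓ)| / a ^ 2 ≤ |g₂ (s + ℓ)| / a₁ ^ 2 :=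
      div_le_div_of_nonneg_left (abs_nonneg _) (by positivity) (pow_le_pow_left₀ ha₁.le ha.1 2)
    linarith
  have hBs : ∀ t : ℝ, s + ℓ ≤ t → -B ≤ g t := fun t ht => hB t (by linarith [hs.1])
  have hlow := fwdAvg_lower hd0 hd1 hd2 hc3 hM₀ ha0 hℓ hs.2 hM3s hPs hBs
  -- (2) the Taylor lower bound at s (with w ≤ W)
  have hM3x : ∀ t ∈ Icc s x', |g₃ t| ≤ M₃ := fun t ht => hM3s t ⟨ht.1, by linarith [ht.2]⟩
  have hT := taylor_T_lower hd0 hd1 hd2 hs.2 ha0 hM3x hd hF1 hF20 hF2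
  have hTW : F₂ / (2 * a ^ 2) - d - F₁ * (1 / a + W) - M₃ * (W ^ 3 / 6 + W ^ 2 / (2 * a) + W / a ^ 2) ≤
      g s + g₁ s / a + g₂ s / a ^ 2 := by
    have h1 : F₁ * (1 / a + (x' - s)) ≤ F₁ * (1 / a + W) := mul_le_mul_of_nonneg_left (by linarith) hF1nn
    have h2 : M₃ * ((x' - s) ^ 3 / 6 + (x' - s) ^ 2 / (2 * a) + (x' - s) / a ^ 2) ≤
        M₃ * (W ^ 3 / 6 + W ^ 2 / (2 * a) + W / a ^ 2) := by
      refine mul_le_mul_of_nonneg_left ?_ hM3nn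
      have e3 : (x' - s) ^ 3 ≤ W ^ 3 := pow_le_pow_left₀ hw0 hwW 3
      have e2 : (x' - s) ^ 2 ≤ W ^ 2 := pow_le_pow_left₀ hw0 hwW 2
      have e2' : (x' - s) ^ 2 / (2 * a) ≤ W ^ 2 / (2 * a) := div_le_div_of_nonneg_right e2 (by positivity)
      have e1' : (x' - s) / a ^ 2 ≤ W / a ^ 2 := div_le_div_of_nonneg_right hwW ha2.le
      linarith
    linarith
  -- (3) Y := Taylor bound − error terms; 2a²·Y = F₂ − margin(a) > 0
  set Y := F₂ / (2 * a ^ 2) - d - F₁ * (1 / a + W) - M₃ * (W ^ 3 / 6 + W ^ 2 / (2 * a) + W / a ^ 2)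
      - Real.exp (-(a * ℓ)) * (P + B) - M₃ / a ^ 3 with hY
  have hYeq : 2 * a ^ 2 * Y = F₂ - (2 * a ^ 2 * d + 2 * F₁ * (a + a ^ 2 * W) +
      M₃ * (a ^ 2 * W ^ 3 / 3 + a * W ^ 2 + 2 * W + 2 / a) + 2 * a ^ 2 * Real.exp (-(a * ℓ)) * (P + B)) := by
    rw [hY]
    field_simp
    ring
  have h2a : 0 < 2 * a ^ 2 := by positivity
  have hYpos : 0 < Y := by
    have h : 0 < 2 * a ^ 2 * Y := by rw [hYeq]; linarith
    by_contra hle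
    push Not at hle
    have := mul_nonpos_iff.2 (Or.inl ⟨h2a.le, hle⟩)
    linarith
  -- (4) conclude
  have hX : Y ≤ g s + g₁ s / a + g₂ s / a ^ 2 - Real.exp (-(a * ℓ)) * (P + B) - M₃ / a ^ 3 := by
    rw [hY]; linarith
  have hprod : 0 < a * ∫ t in Ioi (0:ℝ), g (s + t) * Real.exp (-(a * t)) := by linarith
  by_contra hle
  push Not at hle
  have := mul_nonpos_iff.2 (Or.inl ⟨ha0.le, hle⟩)
  linarith

/-! ## The dip certificate for `H_0` (route item `LinearRayDipCertificate`) -/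

/-- **The quadrature-free dip certificate** (`stmt-RiemannHypothesis-21602`, verbatim): at a dip (`σ = 1`) or
bump (`σ = −1`) of `H_0 = deBruijnH 0` with the six certified numbers `d, F₁, F₂, M₃, P, B` and the margin
inequality, the linear-factor ray `HasOnlyRealZeros (linearFactorH a)` fails for every `a ∈ [a₁, a₂]`.
Proof: `dip_fwdAvg_pos` for `g = σ·Re H_0^{(0)}` (derivative data `σ·Re H_0^{(k)}` from `XiMoments` via
`LinearRayFiniteReach`), then the tree's two-point certificate `LinearRayTwoPoint.not_linearRay_of_signChange(′)`.
[folklore] -/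
theorem linearRayDipCertificate : ∀ (σ x x' ℓ a₁ a₂ d F₁ F₂ M₃ P B : ℝ), (σ = 1 ∨ σ = -1) → 0 ≤ x → x < x' →
    0 < ℓ → 0 < a₁ → 2 ≤ a₁ * ℓ → a₁ ≤ a₂ → 0 ≤ B →
    0 < σ * (deBruijnH 0 ((x : ℝ) : ℂ)).re → σ * (deBruijnH 0 ((x' : ℝ) : ℂ)).re < 0 →
    -d ≤ σ * (deBruijnH 0 ((x' : ℝ) : ℂ)).re → |(deBruijnH0Deriv 1 ((x' : ℝ) : ℂ)).re| ≤ F₁ →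
    F₂ ≤ σ * (deBruijnH0Deriv 2 ((x' : ℝ) : ℂ)).re →
    (∀ t ∈ Set.Icc x (x' + ℓ), |(deBruijnH0Deriv 3 ((t : ℝ) : ℂ)).re| ≤ M₃) →
    (∀ t ∈ Set.Icc (x + ℓ) (x' + ℓ), |(deBruijnH0Deriv 0 ((t : ℝ) : ℂ)).re| +
      |(deBruijnH0Deriv 1 ((t : ℝ) : ℂ)).re| / a₁ + |(deBruijnH0Deriv 2 ((t : ℝ) : ℂ)).re| / a₁ ^ 2 ≤ P) →
    (∀ t : ℝ, x + ℓ ≤ t → -B ≤ σ * (deBruijnH 0 ((t : ℝ) : ℂ)).re) →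
    2 * a₂ ^ 2 * d + 2 * F₁ * (a₂ + a₂ ^ 2 * (x' - x)) +
      M₃ * (a₂ ^ 2 * (x' - x) ^ 3 / 3 + a₂ * (x' - x) ^ 2 + 2 * (x' - x) + 2 / a₁) +
      2 * a₁ ^ 2 * Real.exp (-(a₁ * ℓ)) * (P + B) < F₂ →
    ∀ a ∈ Set.Icc a₁ a₂, ¬ HasOnlyRealZeros (linearFactorH a) := by
  intro σ x x' ℓ a₁ a₂ d F₁ F₂ M₃ P B hσ hx hxx' hℓ ha₁ haℓ h12 hB0 hHx hHx' hd hF1 hF2 hM3 hP hB hmargin a ha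
  have ha0 : 0 < a := lt_of_lt_of_le ha₁ ha.1
  have hσabs : |σ| = 1 := by rcases hσ with rfl | rfl <;> norm_num
  have hσsq : σ * σ = 1 := by rcases hσ with rfl | rfl <;> norm_num
  -- the derivative data g_k = σ · Re H_0^{(k)}
  set g : ℝ → ℝ := fun t => σ * (deBruijnH0Deriv 0 (t : ℂ)).re with hg
  set g₁ : ℝ → ℝ := fun t => σ * (deBruijnH0Deriv 1 (t : ℂ)).re with hg₁
  set g₂ : ℝ → ℝ := fun t => σ * (deBruijnH0Deriv 2 (t : ℂ)).re with hg₂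
  set g₃ : ℝ → ℝ := fun t => σ * (deBruijnH0Deriv 3 (t : ℂ)).re with hg₃
  have hd0 : ∀ t, HasDerivAt g (g₁ t) t := fun t => (hasDerivAt_re_deBruijnH0Deriv 0 t).const_mul σ
  have hd1 : ∀ t, HasDerivAt g₁ (g₂ t) t := fun t => (hasDerivAt_re_deBruijnH0Deriv 1 t).const_mul σ
  have hd2 : ∀ t, HasDerivAt g₂ (g₃ t) t := fun t => (hasDerivAt_re_deBruijnH0Deriv 2 t).const_mul σ
  have hc3 : Continuous g₃ := continuous_const.mul (continuous_re_deBruijnH0Deriv 3)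
  have habsσ : ∀ (k : ℕ) (t : ℝ), |σ * (deBruijnH0Deriv k (t : ℂ)).re| = |(deBruijnH0Deriv k (t : ℂ)).re| := by
    intro k t; rw [abs_mul, hσabs, one_mul]
  have hM₀ : ∀ t, |g t| ≤ 6 * ∫ u in Ioi (0:ℝ), deBruijnHBound 0 1 u := by
    intro t; rw [hg]; dsimp only; rw [habsσ]; exact abs_re_deBruijnH0Deriv_le_six (by norm_num) t
  -- H_0 = H_0^{(0)} on the real axis
  have hH : ∀ t : ℝ, (deBruijnH 0 ((t : ℝ) : ℂ)).re = (deBruijnH0Deriv 0 ((t : ℝ) : ℂ)).re := fun t =>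
    (re_deBruijnH_derivs t).1
  -- hypotheses for the abstract lemma
  have hd' : -d ≤ g x' := by rw [hg]; dsimp only; rw [← hH]; exact hd
  have hneg' : g x' < 0 := by rw [hg]; dsimp only; rw [← hH]; exact hHx'
  have hF1' : |g₁ x'| ≤ F₁ := by rw [hg₁]; dsimp only; rw [habsσ]; exact hF1
  have hF2' : F₂ ≤ g₂ x' := hF2
  have hM3' : ∀ t ∈ Icc x (x' + ℓ), |g₃ t| ≤ M₃ := fun t ht => by
    rw [hg₃]; dsimp only; rw [habsσ]; exact hM3 t ht
  have hP' : ∀ t ∈ Icc (x + ℓ) (x' + ℓ), |g t| + |g₁ t| / a₁ + |g₂ t| / a₁ ^ 2 ≤ P := fun t ht => by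
    rw [hg, hg₁, hg₂]; dsimp only; rw [habsσ, habsσ, habsσ]; exact hP t ht
  have hB' : ∀ t : ℝ, x + ℓ ≤ t → -B ≤ g t := fun t ht => by
    rw [hg]; dsimp only; rw [← hH]; exact hB t ht
  -- positivity of σ · Re Q_a on [x, x']
  have hpos : ∀ s ∈ Icc x x', 0 < σ * (∫ y in Ioi (0 : ℝ), deBruijnH 0 ((s : ℂ) + y) * (Real.exp (-(a * y)) : ℂ)).re := by
    intro s hs
    have h := dip_fwdAvg_pos hd0 hd1 hd2 hc3 hM₀ hxx' hℓ ha₁ haℓ hB0 hd' hneg' hF1' hF2' hM3' hP' hB' hmargin ha hs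
    rw [re_fwdAvg_eq s ha0, ← MeasureTheory.integral_const_mul]
    have e : (fun t : ℝ => g (s + t) * Real.exp (-(a * t))) =
        fun t : ℝ => σ * ((deBruijnH0Deriv 0 ((s + t : ℝ) : ℂ)).re * Real.exp (-(a * t))) := by
      funext t; rw [hg]; dsimp only; ring
    rw [e] at h
    exact h
  rcases hσ with rfl | rfl
  · -- dip: Q_a > 0 on [x, x'], H_0(x) > 0 > H_0(x')
    refine not_linearRay_of_signChange ha0 hx hxx'.le (fun s hs => by simpa using hpos s hs) ?_ ?_
    · simpa using hHx
    · simpa using hHx'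
  · -- bump: Q_a < 0 on [x, x'], H_0(x) < 0 < H_0(x')
    refine not_linearRay_of_signChange' ha0 hx hxx'.le (fun s hs => by have := hpos s hs; linarith) ?_ ?_
    · linarith
    · linarith

end Summit.RiemannHypothesis.RiemannHypothesis.Theorems.Splittings.LinearRayDipCertificate

end
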